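import Summits.HodgeConjecture.CorCM.Hyp413.A3Liu413FaceTypes
import Summits.HodgeConjecture.CorCM.HypLiu418.A3Liu418Items
import Summits.HodgeConjecture.CorCM.HypLiu418.A3Liu418EtaleItems
import Literature.NumberTheory.GelbartRogawski1991.OscillatorTripleExistenceAndOccurrence
import Literature.NumberTheory.Automorphic.Liu2021.Prop413MultiplicityLeOnePrinted
import Literature.AlgebraicGeometry.ModuliOfAbelianVarieties.SiegelFineModuliSchemeExists
import HarnessLib

/-!
# FLOOR-0 SOCKETS — the five support-item TYPES of the generic floor, in a THESES-FREE module (director g14, s386 (R1))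

Cell `hodgecm-mathlib`; registration home of the five FLOOR-0 support items of route `HCCMUnconditional` (s386 design of record).
This file is DEFINITIONS ONLY: five CLOSED `Prop`s (no theorem, no instance, no notation, no `sorry`, NO `[cite:]`-bearing fact of our own —
each `def` is the TYPE of a binder of ★ `Theorems/HCCMUnconditionalOfGenericFloorV7.lean :: hc_cm_of_generic_floor_v7` (p756419), pasted
BYTE-FOR-BYTE), so that the route file `Theses/HCCMUnconditional.lean` can `import` THIS module and name the sockets by one-token signatures
WITHOUT an import cycle.

WHY A NEW MODULE (director finding s386, 23:26Z): the existing copies of these types — ★ `Theorems/H413SpectrumInterfaces.lean`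
(`…Cruxes.H413.SpectrumInterfaces.{HdictEType, HJ3aType, HoccType}` :90∕:100∕:110), `Cruxes/H413/Lines/F0_U3CohMultOne.lean`,
`Cruxes/H413/Lines/F0_P2aHodgeRealisation.lean` — live in modules whose import closure REACHES `Theses.HCCMUnconditional`
(`H413SpectrumInterfaces → HCCMUnconditionalOfGenericFloorV7 → … → Theses.HCCMUnconditional`), and so does ★
`CorCM/HypLiu418/A3Liu418FaceTypes.lean` (home of `Thm415AtFace`; its line 1 is `import …Theses.HCCMUnconditional`).  The imports of THIS
file are the CARRIER modules only: ★ `CorCM/Hyp413/A3Liu413FaceTypes` (the printed datum vocabulary: `uniformOmegaRep`,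
`DelRec.exists_recordSystem_of_printed`, `liuDictionaryPin`, `HodgeCM.Model.*`, `realUnit`, `e₁`, `frameD`, `ιVE`, …), ★
`CorCM/HypLiu418/A3Liu418Items` (`CV`, `TV`, `UV`, `CarN`), ★ `CorCM/HypLiu418/A3Liu418EtaleItems` (→ ★ `AppendixC.Thm415Pinned`,
`EtaleBettiComparison`, `RestOneLevelInvariantsHom`), ★ `GelbartRogawski1991/OscillatorTripleExistenceAndOccurrence`
(`oscillatorTriple_dictionaryExistence`, `admissible_occursInH1`), ★ `Liu2021/Prop413MultiplicityLeOnePrinted` (`multiplicity_le_one_printed`),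
★ `ModuliOfAbelianVarieties/SiegelFineModuliSchemeExists` (`lan2013_siegelFineModuliScheme`).  IMPORT-CLOSURE CERTIFICATE (BFS over the
`^import Summits.…` lines of the tree, F0-typ1 (g2), 23:4xZ): the closure of these imports does NOT contain
`Summits.HodgeConjecture.HodgeConjecture.Theses.HCCMUnconditional` (numbers on the bus line).

THE FIVE SOCKETS (namespace `Summit.HodgeConjecture.HodgeConjecture.Theorems.F0FloorSockets`):
* `HFType`    — (F)          `abbrev` of ★ `Literature.AlgebraicGeometry.ModuliOfAbelianVarieties.lan2013_siegelFineModuliScheme` (binder `hF`, l. 69);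
* `HdictEType` — III-2 (a)′  the TYPE of binder `hdictE` (ll. 71–75) VERBATIM (= ★ `SpectrumInterfaces.HdictEType` token-identically);
* `HJ3aType`  — III-J3a     the TYPE of binder `hJ3a`  (ll. 76–80) VERBATIM (= ★ `SpectrumInterfaces.HJ3aType`);
* `HoccType`  — III-2 (c)′  the TYPE of binder `hocc`  (ll. 81–85) VERBATIM (= ★ `SpectrumInterfaces.HoccType`);
* `H415Type`  — III-9′      the BODY of ★ `Summit.HodgeConjecture.CorCM.Lines.A3Liu418.Thm415AtFace` (`A3Liu418FaceTypes.lean` :243–252)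
  VERBATIM — a `def`, NOT the `abbrev … := Thm415AtFace` of the s386 sketch, because that decl's module imports the Theses (see above); the
  bridge `H415Type ↔ Thm415AtFace` is `Iff.rfl` in any file importing both (to be filed separately, like `HJ3aType_iff`).
Each body mentions only ★ carriers; the kernel sees the same terms as the floor's binders (same `open`s as FloorV7 ∕ FaceTypes), so every
F0 line's head FOLDS into these sockets by `Iff.rfl`∕`id`.  HONEST LABEL: HC_CM is proved only modulo the printed citations until rung 0 closes;
this file proves nothing.
-/

set_option autoImplicit false

-- the mandated namespace has the single-problem summit's repeated segment (`HodgeConjecture.HodgeConjecture`)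
set_option linter.dupNamespace false

noncomputable section

namespace Summit.HodgeConjecture.HodgeConjecture.Theorems.F0FloorSockets

open scoped TensorProduct Matrix
open NumberField NumberField.InfinitePlace IsDedekindDomain
open HodgeCM.Model HodgeCM.Model.LiuIndex HodgeCM.Model.TowerCarrier
open Summit.HodgeConjecture.CorCM.Model
open Literature.AlgebraicGeometry.Motives (CMType AbelianVariety)
open Literature.AlgebraicGeometry.HodgeTheory Literature.NumberTheory.Automorphic.PicardCM
open Literature.AlgebraicGeometry.ShimuraVarieties Literature.AlgebraicGeometry.ShimuraVarieties.UnitaryCanonicalModel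
open Literature.NumberTheory.ComplexMultiplication
open Literature.NumberTheory.Automorphic
open Literature.NumberTheory.Automorphic.Liu2021 Literature.NumberTheory.Automorphic.Liu2021.AppendixC
open Literature.NumberTheory.Automorphic.Liu2021.AppendixC.RestOne
open Literature.NumberTheory.Automorphic.Liu2021.Def411WeilCarriers (lineOf locF Rep)
open Summit.HodgeConjecture.CorCM.Transposition.OmegaTransport (realUnit)
open HodgeCM.Model.ArchSideTerm (e₁)
open Literature.NumberTheory.GelbartRogawski1991 Literature.NumberTheory.GelbartRogawski1991.UnitaryDualPair
open Literature.RepresentationTheory Literature.RepresentationTheory.Liu2021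
open Summit.HodgeConjecture.CorCM
open Summit.HodgeConjecture.CorCM.Transposition
open Literature.NumberTheory.GelbartRogawski1991.OscillatorTripleDictionary (OccursInH1 IsIsoToOmega)
open Summit.HodgeConjecture.CorCM.Lines.A3Liu418 (CV TV UV CarN)

/-! ## (F) -/

/-- **Socket (F) `HFType`** — the TYPE of binder `hF` of ★ `hc_cm_of_generic_floor_v7` (l. 69): the printed existence statement
[Lan13, Thm. 1.4.1.11 with Cor. 7.2.3.9] as the tree's named fact ★ `lan2013_siegelFineModuliScheme` (programme P1's head). -/
abbrev HFType : Prop :=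
  Literature.AlgebraicGeometry.ModuliOfAbelianVarieties.lan2013_siegelFineModuliScheme

/-! ## III-2 (a)′, III-J3a, III-2 (c)′ — the three H413 rows, VERBATIM binder types of floor V7 -/

set_option synthInstance.maxHeartbeats 400000 in
set_option maxHeartbeats 8000000 in
/-- **Socket III-2 (a)′ `HdictEType`** — the TYPE of binder `hdictE` of ★ `hc_cm_of_generic_floor_v7` (ll. 71–75) BYTE-FOR-BYTE: the ∀-face closure
of ★ `GelbartRogawski1991.oscillatorTriple_dictionaryExistence` at the printed datum (programme P2's head; = ★ `SpectrumInterfaces.HdictEType`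
token-identically). -/
def HdictEType : Prop :=
      ∀ (hDel : Literature.AlgebraicGeometry.ShimuraVarieties.UnitaryCanonicalModel.canonicalModel_exists_printed)
        (F : HodgeCM.CMField) [IsGalois ℚ F] (h6 : 6 ≤ Module.finrank ℚ F) {ι₁ : F →+* ℂ} (V : HodgeCM.HermSpace3 F ι₁) (a₀ : RealScalar F)
        (Φ : CMType F) (hΦ : ι₁ ∈ Φ.1) (i : (I V (repAt a₀) (muLiu ι₁ GramClass.rep))),
        oscillatorTriple_dictionaryExistence (((uniformOmegaRep (Summit.HodgeConjecture.CorCM.DelRec.exists_recordSystem_of_printed hDel) ⟨HodgeCM.CMField.K F⟩ ι₁ ⟨HodgeCM.HermSpace3.Hm V, HodgeCM.HermSpace3.isHermitian V, HodgeCM.HermSpace3.signature_ι₁ V, HodgeCM.HermSpace3.posDef_of_ne V⟩ Φ e₁ (frameD V) (frameD_real V) (frameD_ne V) (ιVE V) (2 * imagUnit (HodgeCM.CMField.K F))⁻¹ (fun _ _ => (Rep.update ↥(maximalRealSubfield (HodgeCM.CMField.K F)) (imagUnitSq (HodgeCM.CMField.K F)) (Rep.ofLineOf ↥(maximalRealSubfield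 (HodgeCM.CMField.K F)) (imagUnitSq (HodgeCM.CMField.K F))) (locF ↥(maximalRealSubfield (HodgeCM.CMField.K F)) (imagUnitSq (HodgeCM.CMField.K F)) (realUnit ⟨HodgeCM.CMField.K F⟩ (repAt a₀ (Sigma.fst i)).1 (repAt a₀ (Sigma.fst i)).2.1 (repAt a₀ (Sigma.fst i)).2.2)) (realUnit ⟨HodgeCM.CMField.K F⟩ (repAt a₀ (Sigma.fst i)).1 (repAt a₀ (Sigma.fst i)).2.1 (repAt a₀ (Sigma.fst i)).2.2) rfl)))).prop413Data ((liuDictionaryPin exists_isReal_hodgeModel_holds hodgePQ_independent_of_hodgeModel_holds BallQuotient.ballQuotientUniformised_holds (cmAbelianVarietyRealised_of_eigenbasis exists_isReal_hodgeModel_holds hodgePQ_independent_of_hodgeModel_holds cmAbelianVarietyEigenbasisRealised_holds) Literature.NumberTheory.Transcendental.arapura2012_cor_15_4_6_holds V (I V (repAt a₀) (muLiu ι₁ GramClass.rep)) (line V (repAt a₀) (muLiu ι₁ GramClass.rep)))).H)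

set_option synthInstance.maxHeartbeats 400000 in
set_option maxHeartbeats 8000000 in
/-- **Socket III-J3a `HJ3aType`** — the TYPE of binder `hJ3a` of ★ `hc_cm_of_generic_floor_v7` (ll. 76–80) BYTE-FOR-BYTE: multiplicity `≤ 1` at the printed
datum (programme P3's head; = ★ `SpectrumInterfaces.HJ3aType` token-identically). -/
def HJ3aType : Prop :=
      ∀ (hDel : Literature.AlgebraicGeometry.ShimuraVarieties.UnitaryCanonicalModel.canonicalModel_exists_printed)
        (F : HodgeCM.CMField) [IsGalois ℚ F] (h6 : 6 ≤ Module.finrank ℚ F) {ι₁ : F →+* ℂ} (V : HodgeCM.HermSpace3 F ι₁) (a₀ : RealScalar F)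
        (Φ : CMType F) (hΦ : ι₁ ∈ Φ.1) (i : (I V (repAt a₀) (muLiu ι₁ GramClass.rep))),
        (((uniformOmegaRep (Summit.HodgeConjecture.CorCM.DelRec.exists_recordSystem_of_printed hDel) ⟨HodgeCM.CMField.K F⟩ ι₁ ⟨HodgeCM.HermSpace3.Hm V, HodgeCM.HermSpace3.isHermitian V, HodgeCM.HermSpace3.signature_ι₁ V, HodgeCM.HermSpace3.posDef_of_ne V⟩ Φ e₁ (frameD V) (frameD_real V) (frameD_ne V) (ιVE V) (2 * imagUnit (HodgeCM.CMField.K F))⁻¹ (fun _ _ => (Rep.update ↥(maximalRealSubfield (HodgeCM.CMField.K F)) (imagUnitSq (HodgeCM.CMField.K F)) (Rep.ofLineOf ↥(maximalRealSubfield (HodgeCM.CMField.K F)) (imagUnitSq (HodgeCM.CMField.K F))) (locF ↥(maximalRealSubfield (HodgeCM.CMField.K F)) (imagUnitSq (HodgeCM.CMField.K F)) (realUnit ⟨HodgeCM.CMField.K F⟩ (repAt a₀ (Sigma.fst i)).1 (repAt a₀ (Sigma.fst i)).2.1 (repAt a₀ (Sigma.fst i)).2.2)) (realUnit ⟨HodgeCM.CMField.K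 F⟩ (repAt a₀ (Sigma.fst i)).1 (repAt a₀ (Sigma.fst i)).2.1 (repAt a₀ (Sigma.fst i)).2.2) rfl)))).prop413Data ((liuDictionaryPin exists_isReal_hodgeModel_holds hodgePQ_independent_of_hodgeModel_holds BallQuotient.ballQuotientUniformised_holds (cmAbelianVarietyRealised_of_eigenbasis exists_isReal_hodgeModel_holds hodgePQ_independent_of_hodgeModel_holds cmAbelianVarietyEigenbasisRealised_holds) Literature.NumberTheory.Transcendental.arapura2012_cor_15_4_6_holds V (I V (repAt a₀) (muLiu ι₁ GramClass.rep)) (line V (repAt a₀) (muLiu ι₁ GramClass.rep)))).H).multiplicity_le_one_printed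

set_option synthInstance.maxHeartbeats 400000 in
set_option maxHeartbeats 8000000 in
/-- **Socket III-2 (c)′ `HoccType`** — the TYPE of binder `hocc` of ★ `hc_cm_of_generic_floor_v7` (ll. 81–85) BYTE-FOR-BYTE: admissible
oscillator triples OCCUR in `H¹` at the printed datum (programme P4's head; = ★ `SpectrumInterfaces.HoccType` token-identically). -/
def HoccType : Prop :=
      ∀ (hDel : Literature.AlgebraicGeometry.ShimuraVarieties.UnitaryCanonicalModel.canonicalModel_exists_printed)
        (F : HodgeCM.CMField) [IsGalois ℚ F] (h6 : 6 ≤ Module.finrank ℚ F) {ι₁ : F →+* ℂ} (V : HodgeCM.HermSpace3 F ι₁) (a₀ : RealScalar F)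
        (Φ : CMType F) (hΦ : ι₁ ∈ Φ.1) (i : (I V (repAt a₀) (muLiu ι₁ GramClass.rep))),
        admissible_occursInH1 (((uniformOmegaRep (Summit.HodgeConjecture.CorCM.DelRec.exists_recordSystem_of_printed hDel) ⟨HodgeCM.CMField.K F⟩ ι₁ ⟨HodgeCM.HermSpace3.Hm V, HodgeCM.HermSpace3.isHermitian V, HodgeCM.HermSpace3.signature_ι₁ V, HodgeCM.HermSpace3.posDef_of_ne V⟩ Φ e₁ (frameD V) (frameD_real V) (frameD_ne V) (ιVE V) (2 * imagUnit (HodgeCM.CMField.K F))⁻¹ (fun _ _ => (Rep.update ↥(maximalRealSubfield (HodgeCM.CMField.K F)) (imagUnitSq (HodgeCM.CMField.K F)) (Rep.ofLineOf ↥(maximalRealSubfield (HodgeCM.CMField.K F)) (imagUnitSq (HodgeCM.CMField.K F))) (locF ↥(maximalRealSubfield (HodgeCM.CMField.K F)) (imagUnitSq (HodgeCM.CMField.K F)) (realUnit ⟨HodgeCM.CMField.K F⟩ (repAt a₀ (Sigma.fst i)).1 (repAt a₀ (Sigma.fst i)).2.1 (repAt a₀ (Sigma.fst i)).2.2)) (realUnit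 ⟨HodgeCM.CMField.K F⟩ (repAt a₀ (Sigma.fst i)).1 (repAt a₀ (Sigma.fst i)).2.1 (repAt a₀ (Sigma.fst i)).2.2) rfl)))).prop413Data ((liuDictionaryPin exists_isReal_hodgeModel_holds hodgePQ_independent_of_hodgeModel_holds BallQuotient.ballQuotientUniformised_holds (cmAbelianVarietyRealised_of_eigenbasis exists_isReal_hodgeModel_holds hodgePQ_independent_of_hodgeModel_holds cmAbelianVarietyEigenbasisRealised_holds) Literature.NumberTheory.Transcendental.arapura2012_cor_15_4_6_holds V (I V (repAt a₀) (muLiu ι₁ GramClass.rep)) (line V (repAt a₀) (muLiu ι₁ GramClass.rep)))).H)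

/-! ## III-9′ — [Liu2021, Thm. 4.15] at the face (programme P5's neighbour), VERBATIM body of ★ `Thm415AtFace` -/

set_option synthInstance.maxHeartbeats 400000 in
set_option maxHeartbeats 8000000 in
/-- **Socket III-9′ `H415Type`** — the TYPE of binder `h415 : Thm415AtFace` of ★ `hc_cm_of_generic_floor_v7` (l. 86), given as the BODY of ★
`Summit.HodgeConjecture.CorCM.Lines.A3Liu418.Thm415AtFace` (`CorCM/HypLiu418/A3Liu418FaceTypes.lean` :243–252) BYTE-FOR-BYTE (that module imports the
Theses, so it cannot be referenced here by name; `H415Type ↔ Thm415AtFace` is `Iff.rfl` wherever both are imported): [Liu2021, Thm. 4.15] BY NAME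
(★ `Thm415Pinned`) instantiated at `(ℭ_V, 𝕌_V at a, ν, A_ν, i_ν)` for every induced étale Hecke datum `X` and every `ι′`. -/
def H415Type : Prop :=
  ∀ (hDel : Literature.AlgebraicGeometry.ShimuraVarieties.UnitaryCanonicalModel.canonicalModel_exists_printed)
      (F : HodgeCM.CMField) [IsGalois ℚ F] (h6 : 6 ≤ Module.finrank ℚ F) {ι₁ : F →+* ℂ} (V : HodgeCM.HermSpace3 F ι₁) (a : RealScalar F)
      (Φ : CMType F) (hΦ : ι₁ ∈ Φ.1) (ν : Literature.NumberTheory.Automorphic.IdeleClassGroup (F : Type) →ₜ* Circle)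
      (hν : IdeleClassGroup.IsConjugateSymplectic (F : Type) ν) (hw : IdeleClassGroup.HasWeight (F : Type) ν 1)
      (ℓ : ℕ) [Fact ℓ.Prime] (X : (CV hDel F V Φ).EtaleHeckeDatum ℓ) (ι' : ℂ ≃+* AlgebraicClosure ℚ_[ℓ])
      (obj : RestOne.ObjOne (AlgHom.id ℚ _) ι₁ hν hw (CarN F ι₁ ν hν)),
      X.IsInducedBy (TV hDel F h6 V Φ) →
        Thm415Pinned (CV hDel F V Φ) (UV hDel F V a Φ) ℓ X ι' ν hν (RestOne.AμOne (AlgHom.id ℚ _) ι₁ hν hw (CarN F ι₁ ν hν) obj)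
          (RestOne.iOne (AlgHom.id ℚ _) ι₁ hν hw (CarN F ι₁ ν hν) obj)

end Summit.HodgeConjecture.HodgeConjecture.Theorems.F0FloorSockets

end
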